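import Mathlib
import Literature.Analysis.FluidPDE.SelfSimilarEulerProfile
import Literature.Analysis.FunctionSpaces.SobolevDomain
import HarnessLib

/-!
# Crux `EulerZoomLiouville.PowerGaugeEulerLiouville` (stmt-NavierStokesRegularity-19832), weak stratum, line `weak_eulerian` (ns-idea-11 g9):
# THE DILATION CALCULUS OF A SUPPORT LAW — tools for `stub_supportDensityLaw` (E3)

Route №10 `EulerZoomLiouville` (NavierStokesRegularity), crux E = stmt-NavierStokesRegularity-19832; width seat ns-ezl-w1 g8 under the LEAD ns-typeII-p2 g15.
Pure real analysis on `ℝ³`, no fluid object.  A measurable set `S ⊆ ℝ³` obeys the SUPPORT LAW of the transport field `W = γy + V`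
(`div(W·1_S) = 3γ·1_S` in `𝒟′(ℝ³)`): `∫_S (3γψ + Dψ[W]) = 0` for every test function `ψ`.  Testing it with the radial DILATES `ψ_r(y) = f(r⁻¹y)`
of a bump `f` (`= 1` on `B̄(0,rIn)`, `= 0` off `B(0,rOut)`) gives, for the normalised mass `q(r) = r⁻³ ∫_S f(r⁻¹y) dy`, the exact law
`q(R) − q(r) = ∫_r^R E(s)/(γ s⁵) ds`, `E(s) = ∫_S Df(s⁻¹y)[V y] dy` (the dilation part of `W` is absorbed by `r∂_r ψ_r = −(y·∇)ψ_r`):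

* for a bump `f : ContDiffBump 0` (explicit argument throughout; no new definitions): the dilates `y ↦ f(r⁻¹y)`, `dil_fderiv_apply`,
  `isTestFunctionOn_dil`, `exists_bound_fderiv_bump`, `fderiv_bump_eq_zero`;
* the functionals are written out as integrals (`F(r) = ∫_S f(r⁻¹y)`, `Φ(r) = ∫_S Df(r⁻¹y)[r⁻¹y]`, `E(r) = ∫_S Df(r⁻¹y)[V y]`);
  `measure_inter_closedBall_le_massF` (`vol(S ∩ B̄_{r·rIn}) ≤ F(r)`), `massF_le_measure_inter_ball` (`F(r) ≤ vol(S ∩ B_{r·rOut})`);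
* `hasDerivAt_massF` (`F′(r) = −Φ(r)/r`, differentiation under the integral), `continuousAt_errE`;
* `supportLaw_dil` (the law tested with `ψ_r`: `3γF + γΦ + r⁻¹E = 0`), `hasDerivAt_massF_div_cube` (`(F/r³)′ = E/(γr⁵)`), `massF_div_cube_sub` (FTC).
[folklore; DiPernaLions1989 §II (renormalised support laws); Chae 2007 Cor. 1 for the Lagrangian version]

WHAT THIS IS NOT: not NS, not E, not E3 — tools; 19832 OPEN.
-/

noncomputable section

-- flat `Theorems/<Route><Decl>…` files of one crux share the namespace of the crux (tree convention)
set_option linter.dupNamespace false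

open MeasureTheory Set Filter Topology Metric Function TopologicalSpace
open scoped ENNReal NNReal ContDiff

namespace Summit.NavierStokesRegularity.NavierStokesRegularity.Theorems.PowerGaugeEulerLiouville.WeakEulerian

open Literature.Analysis Literature.Analysis.FunctionSpaces Literature.Analysis.FluidPDE

/-! ### Dilates of a bump -/

variable (f : ContDiffBump (0 : EuclideanSpace ℝ (Fin 3)))

/-- The dilate `ψ_r(y) = f(r⁻¹y)` of a bump `f` centred at `0` is smooth. -/
theorem contDiff_dil (r : ℝ) {n : ℕ∞} : ContDiff ℝ n fun y : EuclideanSpace ℝ (Fin 3) => f (r⁻¹ • y) :=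
  (f.contDiff (n := n)).comp (contDiff_const_smul r⁻¹)

/-- `ψ_r = 1` on `B̄(0, r·rIn)` (`r > 0`). -/
theorem dil_eq_one {r : ℝ} (hr : 0 < r) {y : EuclideanSpace ℝ (Fin 3)} (hy : ‖y‖ ≤ f.rIn * r) : f (r⁻¹ • y) = 1 := by
  apply f.one_of_mem_closedBall
  rw [mem_closedBall, dist_zero_right, norm_smul, norm_inv, Real.norm_of_nonneg hr.le, inv_mul_le_iff₀ hr]
  linarith

/-- `ψ_r = 0` off `B(0, r·rOut)` (`r > 0`). -/
theorem dil_eq_zero {r : ℝ} (hr : 0 < r) {y : EuclideanSpace ℝ (Fin 3)} (hy : f.rOut * r ≤ ‖y‖) : f (r⁻¹ • y) = 0 := by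
  apply f.zero_of_le_dist
  rw [dist_zero_right, norm_smul, norm_inv, Real.norm_of_nonneg hr.le, le_inv_mul_iff₀ hr]
  linarith

/-- `ψ_r` has compact support (`r > 0`). -/
theorem hasCompactSupport_dil {r : ℝ} (hr : 0 < r) : HasCompactSupport fun y : EuclideanSpace ℝ (Fin 3) => f (r⁻¹ • y) := by
  refine HasCompactSupport.of_support_subset_isCompact (isCompact_closedBall (0 : EuclideanSpace ℝ (Fin 3)) (f.rOut * r)) ?_
  intro y hy
  rw [mem_closedBall, dist_zero_right]
  by_contra h
  exact hy (dil_eq_zero f hr (not_le.1 h).le)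

/-- `ψ_r` is a test function on `ℝ³` (`r > 0`). -/
theorem isTestFunctionOn_dil {r : ℝ} (hr : 0 < r) :
    IsTestFunctionOn (⊤ : Opens (EuclideanSpace ℝ (Fin 3))) fun y : EuclideanSpace ℝ (Fin 3) => f (r⁻¹ • y) :=
  ⟨contDiff_dil f r, hasCompactSupport_dil f hr, fun _ _ => trivial⟩

/-- Chain rule: `Dψ_r(y) = Df(r⁻¹y) ∘ (r⁻¹·)`. -/
theorem hasFDerivAt_dil (r : ℝ) (y : EuclideanSpace ℝ (Fin 3)) :
    HasFDerivAt (fun y : EuclideanSpace ℝ (Fin 3) => f (r⁻¹ • y))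
      ((fderiv ℝ f (r⁻¹ • y)).comp (r⁻¹ • ContinuousLinearMap.id ℝ (EuclideanSpace ℝ (Fin 3)))) y := by
  have h1 : HasFDerivAt (fun y : EuclideanSpace ℝ (Fin 3) => r⁻¹ • y) (r⁻¹ • ContinuousLinearMap.id ℝ (EuclideanSpace ℝ (Fin 3))) y :=
    (hasFDerivAt_id y).const_smul r⁻¹
  have h2 : HasFDerivAt f (fderiv ℝ f (r⁻¹ • y)) (r⁻¹ • y) :=
    ((f.contDiff (n := 1)).differentiable (by simp) _).hasFDerivAt
  exact h2.comp y h1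

/-- `Dψ_r(y)[w] = Df(r⁻¹y)[r⁻¹w]`. -/
theorem dil_fderiv_apply (r : ℝ) (y w : EuclideanSpace ℝ (Fin 3)) :
    fderiv ℝ (fun y : EuclideanSpace ℝ (Fin 3) => f (r⁻¹ • y)) y w = fderiv ℝ f (r⁻¹ • y) (r⁻¹ • w) := by
  rw [(hasFDerivAt_dil f r y).fderiv]
  simp

/-- `Df` is bounded: `‖Df(z)‖ ≤ M` for some `M ≥ 0`. -/
theorem exists_bound_fderiv_bump : ∃ M : ℝ, 0 ≤ M ∧ ∀ z : EuclideanSpace ℝ (Fin 3), ‖fderiv ℝ f z‖ ≤ M := by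
  obtain ⟨C, hC⟩ := ((f.contDiff (n := 1)).continuous_fderiv (by simp)).bounded_above_of_compact_support
    (f.hasCompactSupport.fderiv (𝕜 := ℝ))
  exact ⟨max C 0, le_max_right _ _, fun z => (hC z).trans (le_max_left _ _)⟩

/-- `Df(z) = 0` off `B̄(0, rOut)`. -/
theorem fderiv_bump_eq_zero {z : EuclideanSpace ℝ (Fin 3)} (hz : f.rOut < ‖z‖) : fderiv ℝ f z = 0 := by
  have h : z ∉ tsupport (fderiv ℝ f) := by
    intro h
    have h' := tsupport_fderiv_subset ℝ h
    rw [f.tsupport_eq, mem_closedBall, dist_zero_right] at h'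
    linarith
  exact image_eq_zero_of_notMem_tsupport h

/-- `Df(r⁻¹y) = 0` when `r·rOut < ‖y‖` (`r > 0`). -/
theorem fderiv_bump_dil_eq_zero {r : ℝ} (hr : 0 < r) {y : EuclideanSpace ℝ (Fin 3)} (hy : f.rOut * r < ‖y‖) :
    fderiv ℝ f (r⁻¹ • y) = 0 := by
  apply fderiv_bump_eq_zero
  rw [norm_smul, norm_inv, Real.norm_of_nonneg hr.le, lt_inv_mul_iff₀ hr]
  linarith

/-! ### The three radial functionals `F(r) = ∫_S f(r⁻¹y)`, `Φ(r) = ∫_S Df(r⁻¹y)[r⁻¹y]`, `E(r) = ∫_S Df(r⁻¹y)[V y]` -/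

variable {S : Set (EuclideanSpace ℝ (Fin 3))} {V : EuclideanSpace ℝ (Fin 3) → EuclideanSpace ℝ (Fin 3)} {γ : ℝ}

/-- A continuous compactly supported real function is integrable on `S`. -/
theorem integrableOn_of_continuous_hasCompactSupport {g : EuclideanSpace ℝ (Fin 3) → ℝ} (hg : Continuous g) (hgs : HasCompactSupport g) :
    IntegrableOn g S volume :=
  (hg.integrable_of_hasCompactSupport hgs).integrableOn

/-- `ψ_r` is integrable on `S` (`r > 0`). -/
theorem integrableOn_dil {r : ℝ} (hr : 0 < r) : IntegrableOn (fun y : EuclideanSpace ℝ (Fin 3) => f (r⁻¹ • y)) S volume :=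
  integrableOn_of_continuous_hasCompactSupport (contDiff_dil f r (n := 0)).continuous (hasCompactSupport_dil f hr)

/-- `y ↦ Df(r⁻¹y)` is continuous. -/
theorem continuous_fderiv_bump_dil (r : ℝ) : Continuous fun y : EuclideanSpace ℝ (Fin 3) => fderiv ℝ f (r⁻¹ • y) :=
  ((f.contDiff (n := 1)).continuous_fderiv (by simp)).comp (continuous_const_smul r⁻¹)

/-- `y ↦ Df(r⁻¹y)[r⁻¹y]` is integrable on `S` (`r > 0`; continuous with support in `B̄(0, r·rOut)`). -/
theorem integrableOn_fderiv_bump_apply_self {r : ℝ} (hr : 0 < r) :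
    IntegrableOn (fun y : EuclideanSpace ℝ (Fin 3) => fderiv ℝ f (r⁻¹ • y) (r⁻¹ • y)) S volume := by
  refine integrableOn_of_continuous_hasCompactSupport ((continuous_fderiv_bump_dil f r).clm_apply (continuous_const_smul r⁻¹)) ?_
  refine HasCompactSupport.of_support_subset_isCompact (isCompact_closedBall (0 : EuclideanSpace ℝ (Fin 3)) (f.rOut * r)) ?_
  intro y hy
  rw [mem_closedBall, dist_zero_right]
  by_contra h
  exact hy (by simp only [fderiv_bump_dil_eq_zero f hr (not_le.1 h), zero_apply])

/-- `y ↦ Df(r⁻¹y)[V y]` is integrable for locally integrable `V` (`r > 0`; dominated by `M‖V‖·1_{B(0, 2r·rOut)}`). -/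
theorem integrable_fderiv_bump_apply {r : ℝ} (hr : 0 < r) (hV : LocallyIntegrable V volume) :
    Integrable (fun y : EuclideanSpace ℝ (Fin 3) => fderiv ℝ f (r⁻¹ • y) (V y)) volume := by
  obtain ⟨M, hM0, hM⟩ := exists_bound_fderiv_bump f
  have hO : 0 < f.rOut := f.rOut_pos
  have hVb : IntegrableOn V (ball (0 : EuclideanSpace ℝ (Fin 3)) (2 * f.rOut * r)) volume :=
    (hV.integrableOn_isCompact (isCompact_closedBall (0 : EuclideanSpace ℝ (Fin 3)) (2 * f.rOut * r))).mono_set ball_subset_closedBall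
  have hVbM : IntegrableOn (fun y => M * ‖V y‖) (ball (0 : EuclideanSpace ℝ (Fin 3)) (2 * f.rOut * r)) volume := hVb.norm.const_mul M
  have hdom : Integrable ((ball (0 : EuclideanSpace ℝ (Fin 3)) (2 * f.rOut * r)).indicator fun y => M * ‖V y‖) volume :=
    hVbM.integrable_indicator measurableSet_ball
  have hm : AEStronglyMeasurable (fun y : EuclideanSpace ℝ (Fin 3) => fderiv ℝ f (r⁻¹ • y) (V y)) volume :=
    Continuous.comp_aestronglyMeasurable₂ (g := fun (L : EuclideanSpace ℝ (Fin 3) →L[ℝ] ℝ) (v : EuclideanSpace ℝ (Fin 3)) => L v)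
      (isBoundedBilinearMap_apply (𝕜 := ℝ) (E := EuclideanSpace ℝ (Fin 3)) (F := ℝ)).continuous
      (continuous_fderiv_bump_dil f r).aestronglyMeasurable hV.aestronglyMeasurable
  refine hdom.mono' hm (Eventually.of_forall fun y => ?_)
  by_cases hy : f.rOut * r < ‖y‖
  · rw [fderiv_bump_dil_eq_zero f hr hy, zero_apply, norm_zero]
    exact Set.indicator_nonneg (fun z _ => by positivity) y
  · have hyb : y ∈ ball (0 : EuclideanSpace ℝ (Fin 3)) (2 * f.rOut * r) := by
      rw [mem_ball, dist_zero_right]; nlinarith [not_lt.1 hy]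
    rw [Set.indicator_of_mem hyb]
    exact ((fderiv ℝ f (r⁻¹ • y)).le_opNorm (V y)).trans (mul_le_mul_of_nonneg_right (hM _) (norm_nonneg _))

/-- `0 ≤ F(r)`. -/
theorem massF_nonneg (r : ℝ) : 0 ≤ ∫ y in S, f (r⁻¹ • y) :=
  integral_nonneg fun _ => f.nonneg

/-- `∫_S 1_A = vol(S ∩ A)` for measurable `A`. -/
theorem setIntegral_indicator_one {A : Set (EuclideanSpace ℝ (Fin 3))} (hA : MeasurableSet A) :
    ∫ y in S, A.indicator (fun _ => (1 : ℝ)) y = (volume (S ∩ A)).toReal := by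
  rw [integral_indicator hA, Measure.restrict_restrict hA, integral_const, smul_eq_mul, mul_one, measureReal_restrict_apply_univ,
    Set.inter_comm A S]
  rfl

/-- `vol(S ∩ B̄(0, r·rIn)) ≤ F(r)` (`r > 0`). -/
theorem measure_inter_closedBall_le_massF {r : ℝ} (hr : 0 < r) :
    (volume (S ∩ closedBall (0 : EuclideanSpace ℝ (Fin 3)) (f.rIn * r))).toReal ≤ ∫ y in S, f (r⁻¹ • y) := by
  rw [← setIntegral_indicator_one measurableSet_closedBall]
  refine setIntegral_mono ?_ (integrableOn_dil f hr) fun y => ?_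
  · exact (((integrableOn_const_iff (C := (1 : ℝ))).2 (Or.inr measure_closedBall_lt_top)).integrable_indicator
      measurableSet_closedBall).integrableOn
  · by_cases hy : y ∈ closedBall (0 : EuclideanSpace ℝ (Fin 3)) (f.rIn * r)
    · rw [Set.indicator_of_mem hy]
      rw [mem_closedBall, dist_zero_right] at hy
      exact (dil_eq_one f hr hy).symm.le
    · rw [Set.indicator_of_notMem hy]
      exact f.nonneg

/-- `F(r) ≤ vol(S ∩ B(0, r·rOut))` (`r > 0`). -/
theorem massF_le_measure_inter_ball {r : ℝ} (hr : 0 < r) :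
    ∫ y in S, f (r⁻¹ • y) ≤ (volume (S ∩ ball (0 : EuclideanSpace ℝ (Fin 3)) (f.rOut * r))).toReal := by
  rw [← setIntegral_indicator_one measurableSet_ball]
  refine setIntegral_mono (integrableOn_dil f hr) ?_ fun y => ?_
  · exact (((integrableOn_const_iff (C := (1 : ℝ))).2 (Or.inr measure_ball_lt_top)).integrable_indicator
      measurableSet_ball).integrableOn
  · by_cases hy : y ∈ ball (0 : EuclideanSpace ℝ (Fin 3)) (f.rOut * r)
    · rw [Set.indicator_of_mem hy]
      exact f.le_one
    · rw [Set.indicator_of_notMem hy]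
      rw [mem_ball, dist_zero_right, not_lt] at hy
      exact (dil_eq_zero f hr hy).le

/-! ### Differentiation of the mass and continuity of the error -/

/-- **`F′(r) = −Φ(r)/r`** (`r > 0`): differentiation under the integral sign, the `r`-derivative of `f(r⁻¹y)` being `Df(r⁻¹y)[−r⁻²y]`, dominated on
`r′ ∈ B(r, r/2)` by `(2M·rOut/r)·1_{B(0, 2r·rOut)}`. -/
theorem hasDerivAt_massF {r : ℝ} (hr : 0 < r) :
    HasDerivAt (fun s : ℝ => ∫ y in S, f (s⁻¹ • y)) (-(∫ y in S, fderiv ℝ f (r⁻¹ • y) (r⁻¹ • y)) / r) r := by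
  obtain ⟨M, hM0, hM⟩ := exists_bound_fderiv_bump f
  have hO : 0 < f.rOut := f.rOut_pos
  have hball : ball r (r / 2) ∈ 𝓝 r := ball_mem_nhds r (by positivity)
  have hmem : ∀ x ∈ ball r (r / 2), r / 2 < x ∧ x < 3 * r / 2 := fun x hx => by
    rw [mem_ball, Real.dist_eq, abs_lt] at hx; constructor <;> linarith
  have h := hasDerivAt_integral_of_dominated_loc_of_deriv_le (μ := volume.restrict S) (x₀ := r)
    (F := fun x (y : EuclideanSpace ℝ (Fin 3)) => f (x⁻¹ • y))
    (F' := fun x (y : EuclideanSpace ℝ (Fin 3)) => fderiv ℝ f (x⁻¹ • y) ((-(x ^ 2)⁻¹) • y))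
    (bound := fun y => (ball (0 : EuclideanSpace ℝ (Fin 3)) (2 * f.rOut * r)).indicator (fun _ => 2 * M * f.rOut / r) y) hball
    (Eventually.of_forall fun x => (contDiff_dil f x (n := 0)).continuous.aestronglyMeasurable) (integrableOn_dil f hr)
    (((continuous_fderiv_bump_dil f r).clm_apply (continuous_const_smul _)).aestronglyMeasurable)
    (Eventually.of_forall fun y x hx => ?_) ?_ (Eventually.of_forall fun y x hx => ?_)
  · have e : ∫ y in S, fderiv ℝ f (r⁻¹ • y) ((-(r ^ 2)⁻¹) • y) = -(∫ y in S, fderiv ℝ f (r⁻¹ • y) (r⁻¹ • y)) / r := by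
      have e1 : ∀ y : EuclideanSpace ℝ (Fin 3), fderiv ℝ f (r⁻¹ • y) ((-(r ^ 2)⁻¹) • y) =
          -r⁻¹ * fderiv ℝ f (r⁻¹ • y) (r⁻¹ • y) := fun y => by
        rw [← smul_eq_mul, ← ContinuousLinearMap.map_smul, smul_smul]
        congr 2
        field_simp
      simp_rw [e1]
      rw [integral_const_mul]
      field_simp
    exact h.2.congr_deriv e
  · -- domination
    obtain ⟨hx1, hx2⟩ := hmem x hx
    have hx0 : 0 < x := by linarith
    by_cases hy : f.rOut * x < ‖y‖
    · rw [fderiv_bump_dil_eq_zero f hx0 hy, zero_apply, norm_zero]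
      exact Set.indicator_nonneg (fun z _ => by positivity) y
    · have hyx : ‖y‖ ≤ f.rOut * x := not_lt.1 hy
      have hyb : y ∈ ball (0 : EuclideanSpace ℝ (Fin 3)) (2 * f.rOut * r) := by
        rw [mem_ball, dist_zero_right]; nlinarith
      rw [Set.indicator_of_mem hyb]
      calc ‖fderiv ℝ f (x⁻¹ • y) ((-(x ^ 2)⁻¹) • y)‖ ≤ ‖fderiv ℝ f (x⁻¹ • y)‖ * ‖(-(x ^ 2)⁻¹) • y‖ :=
            ContinuousLinearMap.le_opNorm _ _
        _ ≤ M * ((x ^ 2)⁻¹ * (f.rOut * x)) := by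
            rw [norm_smul, norm_neg, norm_inv, norm_pow, Real.norm_of_nonneg hx0.le]
            exact mul_le_mul (hM _) (mul_le_mul_of_nonneg_left hyx (by positivity)) (by positivity) hM0
        _ = M * f.rOut / x := by field_simp
        _ ≤ 2 * M * f.rOut / r := by
            rw [div_le_div_iff₀ hx0 hr]
            have h' := mul_le_mul_of_nonneg_left (show r ≤ 2 * x by linarith) (mul_nonneg hM0 hO.le)
            linarith
  · exact ((((integrableOn_const_iff (C := 2 * M * f.rOut / r)).2 (Or.inr measure_ball_lt_top)).integrable_indicator
      measurableSet_ball).restrict (s := S))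
  · -- pointwise derivative in the parameter
    obtain ⟨hx1, -⟩ := hmem x hx
    have hx0 : x ≠ 0 := (lt_trans (by positivity) hx1).ne'
    have h1 : HasDerivAt (fun x : ℝ => x⁻¹ • y) ((-(x ^ 2)⁻¹) • y) x := (hasDerivAt_inv hx0).smul_const y
    have h2 : HasFDerivAt f (fderiv ℝ f (x⁻¹ • y)) (x⁻¹ • y) :=
      ((f.contDiff (n := 1)).differentiable (by simp) _).hasFDerivAt
    have h3 := h2.comp_hasDerivAt x h1
    exact h3

/-- **`E` is continuous on `(0,∞)`** for locally integrable `V` (dominated continuity, bound `M‖V‖·1_{B(0, 2r·rOut)}` on `r′ ∈ B(r, r/2)`). -/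
theorem continuousAt_errE {r : ℝ} (hr : 0 < r) (hV : LocallyIntegrable V volume) :
    ContinuousAt (fun s : ℝ => ∫ y in S, fderiv ℝ f (s⁻¹ • y) (V y)) r := by
  obtain ⟨M, hM0, hM⟩ := exists_bound_fderiv_bump f
  have hO : 0 < f.rOut := f.rOut_pos
  have hball : ball r (r / 2) ∈ 𝓝 r := ball_mem_nhds r (by positivity)
  have hmem : ∀ x ∈ ball r (r / 2), r / 2 < x ∧ x < 3 * r / 2 := fun x hx => by
    rw [mem_ball, Real.dist_eq, abs_lt] at hx; constructor <;> linarith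
  have hVb : IntegrableOn V (ball (0 : EuclideanSpace ℝ (Fin 3)) (2 * f.rOut * r)) volume :=
    (hV.integrableOn_isCompact (isCompact_closedBall (0 : EuclideanSpace ℝ (Fin 3)) (2 * f.rOut * r))).mono_set ball_subset_closedBall
  have hmeas : ∀ x : ℝ, AEStronglyMeasurable (fun y : EuclideanSpace ℝ (Fin 3) => fderiv ℝ f (x⁻¹ • y) (V y)) (volume.restrict S) :=
    fun x => Continuous.comp_aestronglyMeasurable₂ (g := fun (L : EuclideanSpace ℝ (Fin 3) →L[ℝ] ℝ) (v : EuclideanSpace ℝ (Fin 3)) => L v)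
      (isBoundedBilinearMap_apply (𝕜 := ℝ) (E := EuclideanSpace ℝ (Fin 3)) (F := ℝ)).continuous
      (continuous_fderiv_bump_dil f x).aestronglyMeasurable hV.aestronglyMeasurable.restrict
  refine continuousAt_of_dominated (μ := volume.restrict S) (F := fun x (y : EuclideanSpace ℝ (Fin 3)) => fderiv ℝ f (x⁻¹ • y) (V y))
    (bound := fun y => (ball (0 : EuclideanSpace ℝ (Fin 3)) (2 * f.rOut * r)).indicator (fun y => M * ‖V y‖) y)
    (Eventually.of_forall hmeas) ?_ ?_ (Eventually.of_forall fun y => ?_)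
  · refine Filter.eventually_of_mem hball fun x hx => Eventually.of_forall fun y => ?_
    obtain ⟨hx1, hx2⟩ := hmem x hx
    have hx0 : 0 < x := by linarith
    by_cases hy : f.rOut * x < ‖y‖
    · rw [fderiv_bump_dil_eq_zero f hx0 hy, zero_apply, norm_zero]
      exact Set.indicator_nonneg (fun z _ => by positivity) y
    · have hyb : y ∈ ball (0 : EuclideanSpace ℝ (Fin 3)) (2 * f.rOut * r) := by
        rw [mem_ball, dist_zero_right]; nlinarith [not_lt.1 hy]
      rw [Set.indicator_of_mem hyb]
      exact ((fderiv ℝ f (x⁻¹ • y)).le_opNorm (V y)).trans (mul_le_mul_of_nonneg_right (hM _) (norm_nonneg _))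
  · have hVbM : IntegrableOn (fun y => M * ‖V y‖) (ball (0 : EuclideanSpace ℝ (Fin 3)) (2 * f.rOut * r)) volume := hVb.norm.const_mul M
    exact (hVbM.integrable_indicator measurableSet_ball).restrict (s := S)
  · have h1 : ContinuousAt (fun x : ℝ => x⁻¹ • y) r := (continuousAt_inv₀ hr.ne').smul continuousAt_const
    have h2 : ContinuousAt (fun x : ℝ => fderiv ℝ f (x⁻¹ • y)) r :=
      ((f.contDiff (n := 1)).continuous_fderiv (by simp)).continuousAt.comp h1
    exact h2.clm_apply continuousAt_const

/-! ### The support law along the dilation family -/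

/-- **The support law tested with `ψ_r`**: if `∫_S (3γψ + Dψ[W]) = 0` for every test `ψ` (`W = γy + V`), then
`3γ F(r) + γ Φ(r) + r⁻¹ E(r) = 0` for every `r > 0`. -/
theorem supportLaw_dil (hV : LocallyIntegrable V volume)
    (hlaw : ∀ ψ : EuclideanSpace ℝ (Fin 3) → ℝ, IsTestFunctionOn (⊤ : Opens (EuclideanSpace ℝ (Fin 3))) ψ →
      ∫ y in S, (3 * γ * ψ y + fderiv ℝ ψ y (selfSimilarTransport γ 0 V y)) = 0)
    {r : ℝ} (hr : 0 < r) :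
    3 * γ * (∫ y in S, f (r⁻¹ • y)) + γ * (∫ y in S, fderiv ℝ f (r⁻¹ • y) (r⁻¹ • y)) +
      r⁻¹ * (∫ y in S, fderiv ℝ f (r⁻¹ • y) (V y)) = 0 := by
  have h := hlaw (fun y => f (r⁻¹ • y)) (isTestFunctionOn_dil f hr)
  have e : ∀ y : EuclideanSpace ℝ (Fin 3), 3 * γ * f (r⁻¹ • y) +
      fderiv ℝ (fun y : EuclideanSpace ℝ (Fin 3) => f (r⁻¹ • y)) y (selfSimilarTransport γ 0 V y) =
      3 * γ * f (r⁻¹ • y) + (γ * fderiv ℝ f (r⁻¹ • y) (r⁻¹ • y) + r⁻¹ * fderiv ℝ f (r⁻¹ • y) (V y)) := fun y => by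
    rw [dil_fderiv_apply, selfSimilarTransport, sub_zero, smul_add, map_add, smul_comm r⁻¹ γ y,
      (fderiv ℝ f (r⁻¹ • y)).map_smul γ (r⁻¹ • y), (fderiv ℝ f (r⁻¹ • y)).map_smul r⁻¹ (V y), smul_eq_mul, smul_eq_mul]
  simp_rw [e] at h
  have i1 : IntegrableOn (fun y : EuclideanSpace ℝ (Fin 3) => 3 * γ * f (r⁻¹ • y)) S volume := (integrableOn_dil f hr).const_mul _
  have i2 : IntegrableOn (fun y : EuclideanSpace ℝ (Fin 3) => γ * fderiv ℝ f (r⁻¹ • y) (r⁻¹ • y)) S volume :=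
    (integrableOn_fderiv_bump_apply_self f hr).const_mul _
  have i3 : IntegrableOn (fun y : EuclideanSpace ℝ (Fin 3) => r⁻¹ * fderiv ℝ f (r⁻¹ • y) (V y)) S volume :=
    (integrable_fderiv_bump_apply f hr hV).integrableOn.const_mul _
  have i23 : IntegrableOn (fun y : EuclideanSpace ℝ (Fin 3) => γ * fderiv ℝ f (r⁻¹ • y) (r⁻¹ • y) + r⁻¹ * fderiv ℝ f (r⁻¹ • y) (V y))
      S volume := i2.add i3
  rw [integral_add i1 i23, integral_add i2 i3, integral_const_mul, integral_const_mul, integral_const_mul] at h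
  linarith

/-- **`(F/r³)′ = E/(γr⁵)`** at every `r > 0` (`γ ≠ 0`), from `F′ = −Φ/r` and the support law `3γF + γΦ + r⁻¹E = 0`. -/
theorem hasDerivAt_massF_div_cube (hγ : γ ≠ 0) (hV : LocallyIntegrable V volume)
    (hlaw : ∀ ψ : EuclideanSpace ℝ (Fin 3) → ℝ, IsTestFunctionOn (⊤ : Opens (EuclideanSpace ℝ (Fin 3))) ψ →
      ∫ y in S, (3 * γ * ψ y + fderiv ℝ ψ y (selfSimilarTransport γ 0 V y)) = 0)
    {r : ℝ} (hr : 0 < r) :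
    HasDerivAt (fun s : ℝ => (∫ y in S, f (s⁻¹ • y)) / s ^ 3) ((∫ y in S, fderiv ℝ f (r⁻¹ • y) (V y)) / (γ * r ^ 5)) r := by
  have hF := hasDerivAt_massF f (S := S) hr
  have hpow : HasDerivAt (fun s : ℝ => s ^ 3) (3 * r ^ 2) r := by simpa using hasDerivAt_pow 3 r
  have h := hF.div hpow (pow_ne_zero 3 hr.ne')
  refine h.congr_deriv ?_
  have hL := supportLaw_dil f (S := S) hV hlaw hr
  generalize (∫ y in S, f (r⁻¹ • y)) = A at hL ⊢
  generalize (∫ y in S, fderiv ℝ f (r⁻¹ • y) (r⁻¹ • y)) = B at hL ⊢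
  generalize (∫ y in S, fderiv ℝ f (r⁻¹ • y) (V y)) = C at hL ⊢
  have hr0 : r ≠ 0 := hr.ne'
  have hC : C = -(r * (3 * γ * A + γ * B)) := by
    field_simp at hL
    linear_combination hL
  rw [hC]
  field_simp
  ring

/-- **FTC: `F(R)/R³ − F(r)/r³ = ∫_r^R E(s)/(γs⁵) ds`** for `0 < r ≤ R` (`γ ≠ 0`, `V ∈ L¹_loc`, support law). -/
theorem massF_div_cube_sub (hγ : γ ≠ 0) (hV : LocallyIntegrable V volume)
    (hlaw : ∀ ψ : EuclideanSpace ℝ (Fin 3) → ℝ, IsTestFunctionOn (⊤ : Opens (EuclideanSpace ℝ (Fin 3))) ψ →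
      ∫ y in S, (3 * γ * ψ y + fderiv ℝ ψ y (selfSimilarTransport γ 0 V y)) = 0)
    {r R : ℝ} (hr : 0 < r) (hrR : r ≤ R) :
    (∫ y in S, f (R⁻¹ • y)) / R ^ 3 - (∫ y in S, f (r⁻¹ • y)) / r ^ 3 =
      ∫ s in r..R, (∫ y in S, fderiv ℝ f (s⁻¹ • y) (V y)) / (γ * s ^ 5) := by
  have hderiv : ∀ s ∈ uIcc r R, HasDerivAt (fun s : ℝ => (∫ y in S, f (s⁻¹ • y)) / s ^ 3)
      ((∫ y in S, fderiv ℝ f (s⁻¹ • y) (V y)) / (γ * s ^ 5)) s := fun s hs => by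
    rw [uIcc_of_le hrR] at hs
    exact hasDerivAt_massF_div_cube f hγ hV hlaw (lt_of_lt_of_le hr hs.1)
  have hcont : ContinuousOn (fun s : ℝ => (∫ y in S, fderiv ℝ f (s⁻¹ • y) (V y)) / (γ * s ^ 5)) (uIcc r R) := by
    rw [uIcc_of_le hrR]
    refine ContinuousOn.div (fun s hs => (continuousAt_errE f (lt_of_lt_of_le hr hs.1) hV).continuousWithinAt)
      (continuousOn_const.mul (continuousOn_pow 5)) fun s hs => ?_
    exact mul_ne_zero hγ (pow_ne_zero 5 (lt_of_lt_of_le hr hs.1).ne')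
  rw [intervalIntegral.integral_eq_sub_of_hasDerivAt hderiv (hcont.intervalIntegrable)]

end Summit.NavierStokesRegularity.NavierStokesRegularity.Theorems.PowerGaugeEulerLiouville.WeakEulerian

end
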